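import Mathlib
import Literature.NumberTheory.Sieve.LargeSieveCharacters
import Literature.NumberTheory.QuadraticFields.JacobiCharacterPrimitiveProofs
import HarnessLib

/-!
# Route `IsogenyRedei`, crux `SplitBlockJacobi` (stmt-Parity-11583), line `cofactor-root-discrepancy`:
# the large-sieve box bound for the expected part (helper 1/3 towards `stub_expectedPart`)

The expected part of the line is the free bilinear sum
`E_θ(x) = Σ_{(Q,Q′)} (Q|Q′) · 4x/(QQ′)` over prime pairs `Q ≡ Q′ ≡ 1 (mod 4)`,
`x^θ < Q < Q′`, `QQ′ ≤ x² + 1`.  After quadratic reciprocity `(Q|Q′) = (Q′|Q) = χ_Q(Q′)` with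
`χ_Q = (·|Q)` the quadratic Dirichlet character modulo the prime `Q` (tree:
`Literature.NumberTheory.QuadraticFields.jacobiChar`, primitive by `isPrimitive_jacobiChar`), the
sum restricted to a dyadic box `Q ∈ [2^i, 2^{i+1})`, `Q′ ∈ [2^j, 2^{j+1})` is a character sum to
prime moduli `≤ 2^{i+1}` with coefficients `1/Q′` on a window of length `2^j`, and the
multiplicative large sieve (tree: `Literature.NumberTheory.Sieve.LargeSieve.largeSieve_character_nat`,
Cojocaru–Murty Thm 8.3.1) bounds its mean square.

Main results (both for arbitrary finite sets `T` of odd primes in `[2^i, 2^{i+1})` and `S ⊆ [2^j, 2^{j+1})`):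

* `sum_sq_sum_jacobiSym_div_le`:
  `Σ_{Q ∈ T} (Σ_{n ∈ S} (n|Q)/n)² ≤ (2^j + 1 + 2·(2^{i+1})²)/2^j`;
* `sq_sum_abs_sum_jacobiSym_div_le` (Cauchy–Schwarz over `Q`, `#T ≤ 2^i`):
  `(Σ_{Q ∈ T} |Σ_{n ∈ S} (n|Q)/n|)² ≤ 2^{i+1} + 2^{3i+3}/2^j`;
* `abs_boxSum_jacobiSym_le`: the box `B_i(θ,x) × B_j` of the expected part contributes at most
  `16x/2^K` once `j ≥ i + 2K + 1` and `2K ≤ i + 1`.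

No new definitions; everything is proved (no named facts).
-/

noncomputable section

open Finset
open scoped NumberTheorySymbols

namespace Summit.Parity.BatemanHorn.Cruxes.SplitBlockJacobi.CofactorRootDiscrepancy

open Literature.NumberTheory.QuadraticFields Literature.NumberTheory.Sieve.LargeSieve

open scoped Classical in
/-- **Large sieve for the Legendre characters of the primes of a dyadic box.**  For a finite set
`T` of odd primes `Q < 2^{i+1}` and a finite set `S ⊆ [2^j, 2^{j+1})`,
`Σ_{Q ∈ T} (Σ_{n ∈ S} (n|Q)/n)² ≤ (2^j + 1 + 2·(2^{i+1})²)/2^j`.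
Proof: apply `largeSieve_character_nat` with moduli `≤ 2^{i+1}`, window `(2^j − 1, 2^{j+1} − 1]`
and coefficients `a_n = 1/n · 1_S(n)`; keep on the left only the moduli `Q ∈ T` and the primitive
character `χ_Q = (·|Q)`, drop the weight `Q/φ(Q) ≥ 1`; on the right `Σ |a_n|² ≤ #S/4^j ≤ 1/2^j`.
[folklore] -/
theorem sum_sq_sum_jacobiSym_div_le (i j : ℕ) {T S : Finset ℕ}
    (hT : ∀ Q ∈ T, Q.Prime ∧ Q ≠ 2 ∧ Q < 2 ^ (i + 1))
    (hS : ∀ n ∈ S, 2 ^ j ≤ n ∧ n < 2 ^ (j + 1)) :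
    ∑ Q ∈ T, (∑ n ∈ S, (J(n | Q) : ℝ) / n) ^ 2 ≤
      ((2 : ℝ) ^ j + 1 + 2 * ((2 : ℝ) ^ (i + 1)) ^ 2) / 2 ^ j := by
  -- parameters of the large sieve
  set Qm : ℕ := 2 ^ (i + 1) with hQm
  set M₀ : ℕ := 2 ^ j - 1 with hM₀
  set N : ℕ := 2 ^ j with hN
  set a : ℕ → ℂ := fun n => if n ∈ S then ((n : ℂ))⁻¹ else 0 with ha
  have hj1 : 1 ≤ 2 ^ j := Nat.one_le_two_pow
  have hSsub : S ⊆ Ioc M₀ (M₀ + N) := by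
    intro n hn
    have h := hS n hn
    rw [mem_Ioc, hM₀, hN]
    rw [pow_succ] at h
    omega
  -- the character sum of `χ_Q` against `a` is the real sum `Σ_{n ∈ S} (n|Q)/n`
  have hsum : ∀ Q ∈ T, ∀ _ : NeZero Q,
      ∑ n ∈ Ioc M₀ (M₀ + N), a n * jacobiChar Q n =
        ((∑ n ∈ S, (J(n | Q) : ℝ) / n : ℝ) : ℂ) := by
    intro Q _ _
    calc ∑ n ∈ Ioc M₀ (M₀ + N), a n * jacobiChar Q n
        = ∑ n ∈ Ioc M₀ (M₀ + N), (if n ∈ S then ((n : ℂ))⁻¹ * jacobiChar Q n else 0) := by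
          refine sum_congr rfl fun n _ => ?_
          simp only [ha]
          split_ifs <;> simp
      _ = ∑ n ∈ Ioc M₀ (M₀ + N) ∩ S, ((n : ℂ))⁻¹ * jacobiChar Q n := sum_ite_mem _ _ _
      _ = ∑ n ∈ S, ((n : ℂ))⁻¹ * jacobiChar Q n := by rw [inter_eq_right.mpr hSsub]
      _ = ((∑ n ∈ S, (J(n | Q) : ℝ) / n : ℝ) : ℂ) := by
          rw [Complex.ofReal_sum]
          refine sum_congr rfl fun n _ => ?_
          rw [jacobiChar_natCast]
          push_cast
          ring
  -- the `ℓ²` norm of the coefficients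
  have hnorm : ∑ n ∈ Ioc M₀ (M₀ + N), ‖a n‖ ^ 2 ≤ 1 / (2 : ℝ) ^ j := by
    calc ∑ n ∈ Ioc M₀ (M₀ + N), ‖a n‖ ^ 2
        = ∑ n ∈ Ioc M₀ (M₀ + N), (if n ∈ S then ‖((n : ℂ))⁻¹‖ ^ 2 else 0) := by
          refine sum_congr rfl fun n _ => ?_
          simp only [ha]
          split_ifs <;> simp
      _ = ∑ n ∈ Ioc M₀ (M₀ + N) ∩ S, ‖((n : ℂ))⁻¹‖ ^ 2 := sum_ite_mem _ _ _
      _ = ∑ n ∈ S, ‖((n : ℂ))⁻¹‖ ^ 2 := by rw [inter_eq_right.mpr hSsub]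
      _ ≤ ∑ _n ∈ S, (1 / (2 : ℝ) ^ j) ^ 2 := by
          refine sum_le_sum fun n hn => ?_
          have h2n : (2 : ℝ) ^ j ≤ n := by exact_mod_cast (hS n hn).1
          have hpos : (0 : ℝ) < 2 ^ j := by positivity
          rw [norm_inv, Complex.norm_natCast, ← one_div]
          gcongr
      _ = (#S : ℝ) * (1 / (2 : ℝ) ^ j) ^ 2 := by rw [sum_const, nsmul_eq_mul]
      _ ≤ (2 : ℝ) ^ j * (1 / (2 : ℝ) ^ j) ^ 2 := by
          gcongr
          have hcard : #S ≤ #(Ico (2 ^ j) (2 ^ (j + 1))) :=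
            card_le_card fun n hn => mem_Ico.mpr (hS n hn)
          rw [Nat.card_Ico, pow_succ] at hcard
          have : (#S : ℝ) ≤ ((2 ^ j : ℕ) : ℝ) := by exact_mod_cast (by omega : #S ≤ 2 ^ j)
          simpa using this
      _ = 1 / (2 : ℝ) ^ j := by
          have hpos : (0 : ℝ) < 2 ^ j := by positivity
          field_simp
  -- the large sieve
  have hLS := largeSieve_character_nat a M₀ N Qm
  have hTsub : T ⊆ Icc 1 Qm := by
    intro Q hQ
    have h := hT Q hQ
    rw [mem_Icc]
    exact ⟨h.1.one_le, h.2.2.le⟩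
  -- lower bound for the left-hand side
  have hLHS : ∑ Q ∈ T, (∑ n ∈ S, (J(n | Q) : ℝ) / n) ^ 2 ≤
      ∑ q ∈ Icc 1 Qm, (q : ℝ) / q.totient *
        ∑ χ : DirichletCharacter ℂ q with χ.IsPrimitive,
          ‖∑ n ∈ Ioc M₀ (M₀ + N), a n * χ n‖ ^ 2 := by
    refine le_trans (sum_le_sum fun Q hQ => ?_)
      (sum_le_sum_of_subset_of_nonneg hTsub fun q _ _ =>
        mul_nonneg (by positivity) (sum_nonneg fun χ _ => by positivity))
    obtain ⟨hQp, hQ2, -⟩ := hT Q hQ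
    haveI : NeZero Q := ⟨hQp.ne_zero⟩
    have hprim : (jacobiChar Q).IsPrimitive :=
      isPrimitive_jacobiChar (hQp.odd_of_ne_two hQ2) hQp.prime.squarefree
    have h1 : (∑ n ∈ S, (J(n | Q) : ℝ) / n) ^ 2 =
        ‖∑ n ∈ Ioc M₀ (M₀ + N), a n * jacobiChar Q n‖ ^ 2 := by
      rw [hsum Q hQ inferInstance, Complex.norm_real, Real.norm_eq_abs, sq_abs]
    have h2 : ‖∑ n ∈ Ioc M₀ (M₀ + N), a n * jacobiChar Q n‖ ^ 2 ≤
        ∑ χ : DirichletCharacter ℂ Q with χ.IsPrimitive,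
          ‖∑ n ∈ Ioc M₀ (M₀ + N), a n * χ n‖ ^ 2 :=
      single_le_sum (f := fun χ : DirichletCharacter ℂ Q =>
          ‖∑ n ∈ Ioc M₀ (M₀ + N), a n * χ n‖ ^ 2) (fun χ _ => by positivity)
        (mem_filter.mpr ⟨mem_univ _, hprim⟩)
    have h3 : (1 : ℝ) ≤ (Q : ℝ) / Q.totient := by
      rw [le_div_iff₀ (by exact_mod_cast Nat.totient_pos.mpr hQp.pos), one_mul]
      exact_mod_cast Nat.totient_le Q
    have h4 : (0 : ℝ) ≤ ∑ χ : DirichletCharacter ℂ Q with χ.IsPrimitive,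
        ‖∑ n ∈ Ioc M₀ (M₀ + N), a n * χ n‖ ^ 2 := sum_nonneg fun χ _ => by positivity
    calc (∑ n ∈ S, (J(n | Q) : ℝ) / n) ^ 2
        ≤ 1 * ∑ χ : DirichletCharacter ℂ Q with χ.IsPrimitive,
            ‖∑ n ∈ Ioc M₀ (M₀ + N), a n * χ n‖ ^ 2 := by rw [one_mul, h1]; exact h2
      _ ≤ (Q : ℝ) / Q.totient * ∑ χ : DirichletCharacter ℂ Q with χ.IsPrimitive,
            ‖∑ n ∈ Ioc M₀ (M₀ + N), a n * χ n‖ ^ 2 :=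
          mul_le_mul_of_nonneg_right h3 h4
  -- assemble
  have hN' : (N : ℝ) = 2 ^ j := by rw [hN]; push_cast; ring
  have hQm' : (Qm : ℝ) = 2 ^ (i + 1) := by rw [hQm]; push_cast; ring
  have hcoef : (0 : ℝ) ≤ (N : ℝ) + 1 + 2 * (Qm : ℝ) ^ 2 := by positivity
  calc ∑ Q ∈ T, (∑ n ∈ S, (J(n | Q) : ℝ) / n) ^ 2
      ≤ ((N : ℝ) + 1 + 2 * (Qm : ℝ) ^ 2) * ∑ n ∈ Ioc M₀ (M₀ + N), ‖a n‖ ^ 2 := hLHS.trans hLS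
    _ ≤ ((N : ℝ) + 1 + 2 * (Qm : ℝ) ^ 2) * (1 / (2 : ℝ) ^ j) :=
        mul_le_mul_of_nonneg_left hnorm hcoef
    _ = ((2 : ℝ) ^ j + 1 + 2 * ((2 : ℝ) ^ (i + 1)) ^ 2) / 2 ^ j := by
        rw [hN', hQm', mul_one_div]

/-- **Cauchy–Schwarz over the moduli.**  For a finite set `T` of odd primes in `[2^i, 2^{i+1})`
(so `#T ≤ 2^i`) and `S ⊆ [2^j, 2^{j+1})`,
`(Σ_{Q ∈ T} |Σ_{n ∈ S} (n|Q)/n|)² ≤ 2^{i+1} + 2^{3i+3}/2^j`. [folklore] -/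
theorem sq_sum_abs_sum_jacobiSym_div_le (i j : ℕ) {T S : Finset ℕ}
    (hT : ∀ Q ∈ T, Q.Prime ∧ Q ≠ 2 ∧ 2 ^ i ≤ Q ∧ Q < 2 ^ (i + 1))
    (hS : ∀ n ∈ S, 2 ^ j ≤ n ∧ n < 2 ^ (j + 1)) :
    (∑ Q ∈ T, |∑ n ∈ S, (J(n | Q) : ℝ) / n|) ^ 2 ≤
      (2 : ℝ) ^ (i + 1) + (2 : ℝ) ^ (3 * i + 3) / 2 ^ j := by
  have h1 := sum_sq_sum_jacobiSym_div_le i j (T := T) (S := S)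
    (fun Q hQ => ⟨(hT Q hQ).1, (hT Q hQ).2.1, (hT Q hQ).2.2.2⟩) hS
  have hcard : (#T : ℝ) ≤ (2 : ℝ) ^ i := by
    have h : #T ≤ #(Ico (2 ^ i) (2 ^ (i + 1))) :=
      card_le_card fun Q hQ => mem_Ico.mpr (hT Q hQ).2.2
    rw [Nat.card_Ico, pow_succ] at h
    have h' : (#T : ℝ) ≤ ((2 ^ i : ℕ) : ℝ) := by exact_mod_cast (by omega : #T ≤ 2 ^ i)
    simpa using h'
  have hCS : (∑ Q ∈ T, |∑ n ∈ S, (J(n | Q) : ℝ) / n|) ^ 2 ≤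
      #T * ∑ Q ∈ T, |∑ n ∈ S, (J(n | Q) : ℝ) / n| ^ 2 := sq_sum_le_card_mul_sum_sq
  simp only [sq_abs] at hCS
  set A : ℝ := (2 : ℝ) ^ i with hA
  set B : ℝ := (2 : ℝ) ^ j with hB
  have hA0 : 0 ≤ A := by positivity
  have hB1 : 1 ≤ B := one_le_pow₀ (by norm_num)
  have hB0 : 0 < B := by positivity
  have hsum0 : 0 ≤ ∑ Q ∈ T, (∑ n ∈ S, (J(n | Q) : ℝ) / n) ^ 2 :=
    sum_nonneg fun Q _ => by positivity
  have e1 : (2 : ℝ) ^ (i + 1) = 2 * A := by rw [hA, pow_succ]; ring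
  have e3 : (2 : ℝ) ^ (3 * i + 3) = 8 * A ^ 3 := by rw [hA, pow_add, pow_mul']; ring
  rw [e1] at h1
  rw [e1, e3]
  calc (∑ Q ∈ T, |∑ n ∈ S, (J(n | Q) : ℝ) / n|) ^ 2
      ≤ #T * ∑ Q ∈ T, (∑ n ∈ S, (J(n | Q) : ℝ) / n) ^ 2 := hCS
    _ ≤ A * ((B + 1 + 2 * (2 * A) ^ 2) / B) :=
        mul_le_mul hcard h1 hsum0 hA0
    _ = (A * B + A + 8 * A ^ 3) / B := by field_simp; ring
    _ ≤ (2 * A * B + 8 * A ^ 3) / B := by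
        gcongr
        nlinarith [mul_le_mul_of_nonneg_left hB1 hA0]
    _ = 2 * A + 8 * A ^ 3 / B := by field_simp

/-- **The contribution of one far dyadic box to the expected part.**  For a finite set `T` of
primes `Q ≡ 1 (mod 4)` in `[2^i, 2^{i+1})`, a finite set `S` of odd numbers in `[2^j, 2^{j+1})`,
and `K` with `2K ≤ i + 1` and `i + 2K + 1 ≤ j`,
`|Σ_{(Q,n) ∈ T × S} (Q|n) · 4x/(Qn)| ≤ 16x/2^K`.
Quadratic reciprocity `(Q|n) = (n|Q)` (`Q ≡ 1 (mod 4)`, `n` odd) turns the inner sum into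
`(4x/Q) Σ_{n ∈ S} (n|Q)/n`, `1/Q ≤ 2^{-i}`, and `sq_sum_abs_sum_jacobiSym_div_le` gives
`(Σ_Q |Σ_n (n|Q)/n|)² ≤ 2^{i+1} + 2^{3i+3}/2^j ≤ (2^{i+2}/2^K)²`. [folklore] -/
theorem abs_boxSum_jacobiSym_le :
    ∀ (x i j K : ℕ) (T S : Finset ℕ),
      (∀ Q ∈ T, Q.Prime ∧ Q % 4 = 1 ∧ 2 ^ i ≤ Q ∧ Q < 2 ^ (i + 1)) →
      (∀ n ∈ S, Odd n ∧ 2 ^ j ≤ n ∧ n < 2 ^ (j + 1)) →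
      2 * K ≤ i + 1 → i + 2 * K + 1 ≤ j →
      |∑ q ∈ T ×ˢ S, (jacobiSym (q.1 : ℤ) q.2 : ℝ) * (4 * (x : ℝ) / ((q.1 * q.2 : ℕ) : ℝ))| ≤
        16 * (x : ℝ) / 2 ^ K := by
  intro x i j K T S hT hS hK hj
  set A : ℝ := (2 : ℝ) ^ i with hA
  set B : ℝ := (2 : ℝ) ^ j with hB
  set C : ℝ := (2 : ℝ) ^ K with hC
  have hA0 : 0 < A := by positivity
  have hB0 : 0 < B := by positivity
  have hC0 : 0 < C := by positivity
  have hx0 : (0 : ℝ) ≤ x := Nat.cast_nonneg x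
  -- (1) reciprocity and factorisation of the weight
  have hbox : ∑ q ∈ T ×ˢ S, (jacobiSym (q.1 : ℤ) q.2 : ℝ) * (4 * (x : ℝ) / ((q.1 * q.2 : ℕ) : ℝ)) =
      ∑ Q ∈ T, 4 * (x : ℝ) / Q * ∑ n ∈ S, (J(n | Q) : ℝ) / n := by
    rw [sum_product]
    refine sum_congr rfl fun Q hQ => ?_
    rw [mul_sum]
    refine sum_congr rfl fun n hn => ?_
    have hrec : J((Q : ℕ) | n) = J((n : ℕ) | Q) :=
      jacobiSym.quadratic_reciprocity_one_mod_four (hT Q hQ).2.1 (hS n hn).1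
    rw [hrec]
    push_cast
    ring
  -- (2) the sum over `Q` of the absolute inner sums
  have hT' : ∀ Q ∈ T, Q.Prime ∧ Q ≠ 2 ∧ 2 ^ i ≤ Q ∧ Q < 2 ^ (i + 1) := fun Q hQ =>
    ⟨(hT Q hQ).1, by have := (hT Q hQ).2.1; omega, (hT Q hQ).2.2⟩
  have hS' : ∀ n ∈ S, 2 ^ j ≤ n ∧ n < 2 ^ (j + 1) := fun n hn => (hS n hn).2
  have hsq := sq_sum_abs_sum_jacobiSym_div_le i j hT' hS'
  have e1 : (2 : ℝ) ^ (i + 1) = 2 * A := by rw [hA, pow_succ]; ring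
  have e3 : (2 : ℝ) ^ (3 * i + 3) = 8 * A ^ 3 := by rw [hA, pow_add, pow_mul']; ring
  have hBge : 2 * A * C ^ 2 ≤ B := by
    have h : (2 : ℝ) ^ (i + 2 * K + 1) ≤ 2 ^ j := pow_le_pow_right₀ (by norm_num) hj
    have e : (2 : ℝ) ^ (i + 2 * K + 1) = 2 * A * C ^ 2 := by
      rw [hA, hC, pow_add, pow_add, pow_mul']; ring
    rwa [e] at h
  have hCle : C ^ 2 ≤ 2 * A := by
    have h : (2 : ℝ) ^ (2 * K) ≤ 2 ^ (i + 1) := pow_le_pow_right₀ (by norm_num) hK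
    have e : (2 : ℝ) ^ (2 * K) = C ^ 2 := by rw [hC, pow_mul']
    rwa [e, e1] at h
  have hbound : (2 : ℝ) ^ (i + 1) + (2 : ℝ) ^ (3 * i + 3) / 2 ^ j ≤ (4 * A / C) ^ 2 := by
    rw [e1, e3, ← hB]
    have h1 : 8 * A ^ 3 / B ≤ 8 * A ^ 3 / (2 * A * C ^ 2) :=
      div_le_div_of_nonneg_left (by positivity) (by positivity) hBge
    have h2 : 8 * A ^ 3 / (2 * A * C ^ 2) = 4 * A ^ 2 / C ^ 2 := by
      field_simp
      ring
    have h3 : 2 * A ≤ 4 * A ^ 2 / C ^ 2 := by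
      rw [le_div_iff₀ (by positivity)]
      nlinarith [mul_le_mul_of_nonneg_left hCle hA0.le]
    have h4 : (4 * A / C) ^ 2 = 16 * A ^ 2 / C ^ 2 := by
      field_simp
      ring
    rw [h4]
    have h5 : 0 ≤ 4 * A ^ 2 / C ^ 2 := by positivity
    calc 2 * A + 8 * A ^ 3 / B ≤ 4 * A ^ 2 / C ^ 2 + 4 * A ^ 2 / C ^ 2 := by
          linarith [h1.trans_eq h2]
      _ ≤ 16 * A ^ 2 / C ^ 2 := by
          rw [← add_div, div_le_div_iff_of_pos_right (by positivity)]
          nlinarith [sq_nonneg A]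
  have hsumabs : ∑ Q ∈ T, |∑ n ∈ S, (J(n | Q) : ℝ) / n| ≤ 4 * A / C := by
    have h := hsq.trans hbound
    exact (pow_le_pow_iff_left₀ (sum_nonneg fun Q _ => abs_nonneg _) (by positivity)
      two_ne_zero).mp h
  -- (3) assemble
  rw [hbox]
  calc |∑ Q ∈ T, 4 * (x : ℝ) / Q * ∑ n ∈ S, (J(n | Q) : ℝ) / n|
      ≤ ∑ Q ∈ T, |4 * (x : ℝ) / Q * ∑ n ∈ S, (J(n | Q) : ℝ) / n| := abs_sum_le_sum_abs _ _
    _ ≤ ∑ Q ∈ T, 4 * (x : ℝ) / A * |∑ n ∈ S, (J(n | Q) : ℝ) / n| := by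
        refine sum_le_sum fun Q hQ => ?_
        have hQA : A ≤ Q := by rw [hA]; exact_mod_cast (hT Q hQ).2.2.1
        rw [abs_mul, abs_of_nonneg (by positivity : (0 : ℝ) ≤ 4 * x / Q)]
        gcongr
    _ = 4 * (x : ℝ) / A * ∑ Q ∈ T, |∑ n ∈ S, (J(n | Q) : ℝ) / n| := by rw [mul_sum]
    _ ≤ 4 * (x : ℝ) / A * (4 * A / C) :=
        mul_le_mul_of_nonneg_left hsumabs (by positivity)
    _ = 16 * (x : ℝ) / C := by
        field_simp
        ring

end Summit.Parity.BatemanHorn.Cruxes.SplitBlockJacobi.CofactorRootDiscrepancy
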